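import Literature.Combinatorics.Optimization.ShellLawCentredMomentLevelStep
import Literature.Combinatorics.Optimization.ShellLawPinnedSubsums
import HarnessLib

/-!
# The main term of the first level step of the centred second moment: a conditional bound from per-pair
# `x`-smoothness numbers and the pinned-subsum comparability

Continuation of `ShellLawCentredMomentLevelStep.lean` (`main_one_eq`: the frozen-coefficient first level difference
`MAIN₁` of the centred second moment `A^m` is `−(1/(|S|(|S|−2)))` times a signed sum, over the level-step pairs `(p,q)`, of
ONE second `x`-difference of ONE quadratically weighted section on the deleted ground set `S∖e_p∖e_q`) and
`ShellLawPinnedSubsums.lean` (a weighted section of `S∖e_p∖e_q` with `e_q` re-inserted full is a sub-sum of the one on `S`).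
Fix a fixed-point-free involution `π`, a `π`-stable ground set `S`, a block `H`, a cut `t₀+6`, a base level `c₀`, a real
centring `m` and a point `x`. Write the three weighted sections of a ground set `S′` at cut `t′`, level `c₀`, point `y`
`P₁(S′,t′,y) = E[1_{X=y}(n_A−m)²]`, `P₂(S′,t′,y) = E[1_{X=y}n_A(n_A−1)]`, `P₃(S′,t′,y) = E[1_{X=y}n_A]`, and
`θ₂ = (t₀+6−c₀)/(t₀+2−c₀)`, `θ₁ = (t₀+6−c₀)/(t₀+4−c₀)`.

* §1 `combinedSection_eq` — linearity: the weighted section of `main_one_eq` for `A^m` is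
  `W = P₁ + (θ₂−1)P₂ + (θ₁−1)(1−2m)P₃` (`θ₂α(α−1) + θ₁(1−2m)α + m² = (α−m)² + (θ₂−1)α(α−1) + (θ₁−1)(1−2m)α`: the LARGE piece is
  the centred one).
* §2 **`abs_main_one_le`** — THE CONDITIONAL BOUND: if for every `AD` pair (resp. `BB` pair) and `i = 1,2,3`
  `|∇²_x P_i(S_pq,t₀+4,·)(x)| ≤ E·P_i(S_pq,t₀+4,x) + F_i` (resp. `≤ E·P_i(S_pq,t₀+4,x−1) + F_i`) — the shape delivered at level
  `c₀ = 1` by `abs_nab2_iter_weightedSection_one_le` (`ShellLawWeightedPointwiseMixture` §7) with the reference point `x`, resp.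
  `x−1`, inside the stencil — then
  `|MAIN₁| ≤ (#pairs/(|S|(|S|−2)))·[E·R·(P₁(S,t₀+6,x) + (θ₂−1)P₂(S,t₀+6,x) + (θ₁−1)|1−2m|P₃(S,t₀+6,x)) + F₁ + (θ₂−1)F₂ + (θ₁−1)|1−2m|F₃]`,
  `R = |S|(|S|−2)/((t₀+6−c₀)(|S|−t₀−6−c₀))`, `#pairs = |vAA||vDD| + Σ_{p∈vBH}(|vBN|−1)` (the re-inserted edge `e_q` is `H̄H̄`
  for `AD` pairs — no shift — and mixed for `BB` pairs — shift `1`; `weightedSection_del2_le_ratio_mul`).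
  `P₁(S,t₀+6,x) = A^m_{c₀}(x)` is the centred second moment ITSELF; `P₂ ≤ a²·law`, `P₃ ≤ a·law` carry the small factors
  `θ−1 = O(1/(t₀−c₀))`.

All PROVED, 0 sorry, no definitions, no named facts. Cell pnp-psdrank (prover g27, MEMO-30 §2): the `k = 1` main term of
input (ii) of the γ-direction criterion, conditional on the per-pair smoothness numbers; nothing here is about psd rank or P vs NP.

## References
* [Rothvoss2017] T. Rothvoß, *The matching polytope has exponential extension complexity*, J. ACM 64 (2017), §2
  (PDF pp. 5–6): cuts, perfect matchings, the three edge types, the level classes.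
* [RollinRoss2010] A. Röllin, N. Ross, *Local limit theorems via Landau–Kolmogorov inequalities*, Bernoulli 21 (2015)
  851–880, §3 (Lemma 3.1, 3.3: difference operators, mixtures).
-/

noncomputable section

open Finset

namespace Literature.Combinatorics.Optimization

namespace ShellStep

variable {n : ℕ} {π : Fin n → Fin n}

/-! ### §1 Linearity: the combined weight as the centred square plus two small factorial weights -/

/-- **Linearity of weighted sections in the weight**, for the weight of `main_one_eq` at `(u₂,u₁,u₀) = (1, 1−2m, m²)`:
`E[1_{X=y}(θ₂n_A(n_A−1) + (1−2m)θ₁n_A + m²)] = E[1_{X=y}(n_A−m)²] + (θ₂−1)E[1_{X=y}n_A(n_A−1)] + (θ₁−1)(1−2m)E[1_{X=y}n_A]`.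
[cite: Rothvoss2017, §2 (PDF p. 6)] -/
theorem combinedSection_eq (S' H : Finset (Fin n)) (t' c₀ : ℕ) (θ₂ θ₁ m : ℝ) (y : ℤ) :
    (∑ U ∈ ((shellIn π S' t' c₀).filter fun U => ((U ∩ H).card : ℤ) = y),
        (1 * θ₂ * (((((reps π (vAA π S' H)).filter fun v => v ∈ U ∧ π v ∈ U).card : ℕ) : ℝ) *
              (((((reps π (vAA π S' H)).filter fun v => v ∈ U ∧ π v ∈ U).card : ℕ) : ℝ) - 1)) +
          (1 - 2 * m) * θ₁ * ((((reps π (vAA π S' H)).filter fun v => v ∈ U ∧ π v ∈ U).card : ℕ) : ℝ) + m ^ 2)) /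
        ((shellIn π S' t' c₀).card : ℝ) =
      (∑ U ∈ ((shellIn π S' t' c₀).filter fun U => ((U ∩ H).card : ℤ) = y),
          (((((reps π (vAA π S' H)).filter fun v => v ∈ U ∧ π v ∈ U).card : ℕ) : ℝ) - m) ^ 2) /
          ((shellIn π S' t' c₀).card : ℝ) +
        (θ₂ - 1) * ((∑ U ∈ ((shellIn π S' t' c₀).filter fun U => ((U ∩ H).card : ℤ) = y),
          (((((reps π (vAA π S' H)).filter fun v => v ∈ U ∧ π v ∈ U).card : ℕ) : ℝ) *
            (((((reps π (vAA π S' H)).filter fun v => v ∈ U ∧ π v ∈ U).card : ℕ) : ℝ) - 1))) /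
          ((shellIn π S' t' c₀).card : ℝ)) +
        (θ₁ - 1) * (1 - 2 * m) * ((∑ U ∈ ((shellIn π S' t' c₀).filter fun U => ((U ∩ H).card : ℤ) = y),
          ((((reps π (vAA π S' H)).filter fun v => v ∈ U ∧ π v ∈ U).card : ℕ) : ℝ)) /
          ((shellIn π S' t' c₀).card : ℝ)) := by
  rw [mul_div_assoc', mul_div_assoc', ← add_div, ← add_div, mul_sum, mul_sum, ← sum_add_distrib,
    ← sum_add_distrib]
  congr 1
  exact sum_congr rfl fun U _ => by ring

/-- Second differences of a three-term combination, bounded term by term. [cite: RollinRoss2010, §3 (Lemma 3.1)] -/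
theorem abs_nab2_combination_le {P₁ P₂ P₃ : ℤ → ℝ} {a b : ℝ} (ha : 0 ≤ a) (x : ℤ) :
    |(P₁ x + a * P₂ x + b * P₃ x) - 2 * (P₁ (x - 1) + a * P₂ (x - 1) + b * P₃ (x - 1)) +
        (P₁ (x - 2) + a * P₂ (x - 2) + b * P₃ (x - 2))| ≤
      |P₁ x - 2 * P₁ (x - 1) + P₁ (x - 2)| + a * |P₂ x - 2 * P₂ (x - 1) + P₂ (x - 2)| +
        |b| * |P₃ x - 2 * P₃ (x - 1) + P₃ (x - 2)| := by
  have e : (P₁ x + a * P₂ x + b * P₃ x) - 2 * (P₁ (x - 1) + a * P₂ (x - 1) + b * P₃ (x - 1)) +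
      (P₁ (x - 2) + a * P₂ (x - 2) + b * P₃ (x - 2)) =
      (P₁ x - 2 * P₁ (x - 1) + P₁ (x - 2)) + a * (P₂ x - 2 * P₂ (x - 1) + P₂ (x - 2)) +
        b * (P₃ x - 2 * P₃ (x - 1) + P₃ (x - 2)) := by ring
  rw [e]
  refine (abs_add_le _ _).trans (add_le_add ((abs_add_le _ _).trans (add_le_add le_rfl ?_)) ?_)
  · rw [abs_mul, abs_of_nonneg ha]
  · rw [abs_mul]

/-! ### §2 The conditional bound for the main term -/

section Main

variable (hπ : ∀ v, π (π v) = v) (hπ' : ∀ v, π v ≠ v)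
include hπ hπ'

omit hπ hπ' in
/-- `α(α−1) ≥ 0` for a natural number `α`. [cite: Rothvoss2017, §2 (PDF p. 6)] -/
theorem natCast_mul_sub_one_nonneg (α : ℕ) : 0 ≤ (α : ℝ) * ((α : ℝ) - 1) := by
  rcases Nat.eq_zero_or_pos α with h | h
  · rw [h]; simp
  · have h1 : (1 : ℝ) ≤ α := by exact_mod_cast h
    exact mul_nonneg (Nat.cast_nonneg _) (by linarith)

/-- **THE CONDITIONAL BOUND FOR MAIN₁.** `π` a fixed-point-free involution, `S` `π`-stable, `H` a block, a base level
`c₀ < t₀ + 2` with `Shell_S(t₀+6, c₀+2) ≠ ∅`, a centring `m`, a point `x`; `P₁, P₂, P₃` the sections of `(n_A−m)²`, `n_A(n_A−1)`,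
`n_A` (ground set, cut, point; level `c₀`). If for constants `E, F₁, F₂, F₃ ≥ 0` every `AD` pair `(p,q)` satisfies
`|∇²_xP_i(S_pq,t₀+4,·)(x)| ≤ E·P_i(S_pq,t₀+4,x) + F_i` and every `BB` pair `|∇²_xP_i(S_pq,t₀+4,·)(x)| ≤ E·P_i(S_pq,t₀+4,x−1) + F_i`
(`i = 1,2,3`), then the main term of `main_one_eq` for `(u₂,u₁,u₀) = (1,1−2m,m²)` obeys
`|MAIN₁| ≤ (#pairs/(|S|(|S|−2)))·[E·R·(P₁(S,t₀+6,x) + (θ₂−1)P₂(S,t₀+6,x) + (θ₁−1)|1−2m|P₃(S,t₀+6,x)) + F₁ + (θ₂−1)F₂ + (θ₁−1)|1−2m|F₃]`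
with `R = |S|(|S|−2)/((t₀+6−c₀)(|S|−t₀−6−c₀))`, `θ₂ = (t₀+6−c₀)/(t₀+2−c₀)`, `θ₁ = (t₀+6−c₀)/(t₀+4−c₀)`,
`#pairs = |vAA|·|vDD| + Σ_{p∈vBH} |vBN∖{πp}|`. [cite: Rothvoss2017, §2 (PDF p. 6)] [cite: RollinRoss2010, §3 (Lemma 3.3)] -/
theorem abs_main_one_le {S : Finset (Fin n)} (hS : ∀ u ∈ S, π u ∈ S) (H : Finset (Fin n)) {t₀ c₀ : ℕ}
    (hc : c₀ < t₀ + 2) (hne : (shellIn π S (t₀ + 6) (c₀ + 2)).Nonempty) (m : ℝ) (x : ℤ)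
    (P₁ P₂ P₃ : Finset (Fin n) → ℕ → ℤ → ℝ)
    (hP₁ : ∀ S' t' y, P₁ S' t' y = (∑ U ∈ ((shellIn π S' t' c₀).filter fun U => ((U ∩ H).card : ℤ) = y),
        (((((reps π (vAA π S' H)).filter fun v => v ∈ U ∧ π v ∈ U).card : ℕ) : ℝ) - m) ^ 2) /
        ((shellIn π S' t' c₀).card : ℝ))
    (hP₂ : ∀ S' t' y, P₂ S' t' y = (∑ U ∈ ((shellIn π S' t' c₀).filter fun U => ((U ∩ H).card : ℤ) = y),
        (((((reps π (vAA π S' H)).filter fun v => v ∈ U ∧ π v ∈ U).card : ℕ) : ℝ) *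
          (((((reps π (vAA π S' H)).filter fun v => v ∈ U ∧ π v ∈ U).card : ℕ) : ℝ) - 1))) /
        ((shellIn π S' t' c₀).card : ℝ))
    (hP₃ : ∀ S' t' y, P₃ S' t' y = (∑ U ∈ ((shellIn π S' t' c₀).filter fun U => ((U ∩ H).card : ℤ) = y),
        ((((reps π (vAA π S' H)).filter fun v => v ∈ U ∧ π v ∈ U).card : ℕ) : ℝ)) /
        ((shellIn π S' t' c₀).card : ℝ))
    {E F₁ F₂ F₃ : ℝ} (hE : 0 ≤ E) (hF₁ : 0 ≤ F₁) (hF₂ : 0 ≤ F₂) (hF₃ : 0 ≤ F₃)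
    (hXA : ∀ p ∈ vAA π S H, ∀ q ∈ vDD π S H,
      |P₁ (del2 π S p q) (t₀ + 4) x - 2 * P₁ (del2 π S p q) (t₀ + 4) (x - 1) + P₁ (del2 π S p q) (t₀ + 4) (x - 2)| ≤
          E * P₁ (del2 π S p q) (t₀ + 4) x + F₁ ∧
        |P₂ (del2 π S p q) (t₀ + 4) x - 2 * P₂ (del2 π S p q) (t₀ + 4) (x - 1) + P₂ (del2 π S p q) (t₀ + 4) (x - 2)| ≤
          E * P₂ (del2 π S p q) (t₀ + 4) x + F₂ ∧
        |P₃ (del2 π S p q) (t₀ + 4) x - 2 * P₃ (del2 π S p q) (t₀ + 4) (x - 1) + P₃ (del2 π S p q) (t₀ + 4) (x - 2)| ≤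
          E * P₃ (del2 π S p q) (t₀ + 4) x + F₃)
    (hXB : ∀ p ∈ vBH π S H, ∀ q ∈ (vBN π S H).erase (π p),
      |P₁ (del2 π S p q) (t₀ + 4) x - 2 * P₁ (del2 π S p q) (t₀ + 4) (x - 1) + P₁ (del2 π S p q) (t₀ + 4) (x - 2)| ≤
          E * P₁ (del2 π S p q) (t₀ + 4) (x - 1) + F₁ ∧
        |P₂ (del2 π S p q) (t₀ + 4) x - 2 * P₂ (del2 π S p q) (t₀ + 4) (x - 1) + P₂ (del2 π S p q) (t₀ + 4) (x - 2)| ≤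
          E * P₂ (del2 π S p q) (t₀ + 4) (x - 1) + F₂ ∧
        |P₃ (del2 π S p q) (t₀ + 4) x - 2 * P₃ (del2 π S p q) (t₀ + 4) (x - 1) + P₃ (del2 π S p q) (t₀ + 4) (x - 2)| ≤
          E * P₃ (del2 π S p q) (t₀ + 4) (x - 1) + F₃) :
    |1 * ((((t₀ : ℝ) + 6 - c₀) * ((t₀ : ℝ) + 4 - c₀)) / ((S.card : ℝ) * ((S.card : ℝ) - 2))) *
          ((∑ v ∈ reps π (vAA π S H), ∑ w ∈ (reps π (vAA π S H)).erase v,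
              shellLaw π (del2 π S v w) H (t₀ + 2) (c₀ + 2) (x - 4)) -
            ∑ v ∈ reps π (vAA π S H), ∑ w ∈ (reps π (vAA π S H)).erase v,
              shellLaw π (del2 π S v w) H (t₀ + 2) c₀ (x - 4)) +
        (1 - 2 * m) * (((t₀ : ℝ) + 6 - c₀) / (S.card : ℝ)) *
          ((∑ v ∈ reps π (vAA π S H), shellLaw π (S \ {v, π v}) H (t₀ + 4) (c₀ + 2) (x - 2)) -
            ∑ v ∈ reps π (vAA π S H), shellLaw π (S \ {v, π v}) H (t₀ + 4) c₀ (x - 2)) +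
        m ^ 2 * (shellLaw π S H (t₀ + 6) (c₀ + 2) x - shellLaw π S H (t₀ + 6) c₀ x)| ≤
      ((((vAA π S H).card : ℝ) * (vDD π S H).card + ∑ p ∈ vBH π S H, (((vBN π S H).erase (π p)).card : ℝ)) /
          ((S.card : ℝ) * ((S.card : ℝ) - 2))) *
        (E * (((S.card : ℝ) * ((S.card : ℝ) - 2)) / ((((t₀ : ℝ) + 6 - c₀)) * ((S.card : ℝ) - (t₀ + 6) - c₀))) *
            (P₁ S (t₀ + 6) x + (((t₀ : ℝ) + 6 - c₀) / ((t₀ : ℝ) + 2 - c₀) - 1) * P₂ S (t₀ + 6) x +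
              (((t₀ : ℝ) + 6 - c₀) / ((t₀ : ℝ) + 4 - c₀) - 1) * |1 - 2 * m| * P₃ S (t₀ + 6) x) +
          (F₁ + (((t₀ : ℝ) + 6 - c₀) / ((t₀ : ℝ) + 2 - c₀) - 1) * F₂ +
            (((t₀ : ℝ) + 6 - c₀) / ((t₀ : ℝ) + 4 - c₀) - 1) * |1 - 2 * m| * F₃)) := by
  classical
  -- abbreviations and signs
  obtain ⟨θ₂, hθ₂⟩ : ∃ e : ℝ, e = ((t₀ : ℝ) + 6 - c₀) / ((t₀ : ℝ) + 2 - c₀) := ⟨_, rfl⟩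
  obtain ⟨θ₁, hθ₁⟩ : ∃ e : ℝ, e = ((t₀ : ℝ) + 6 - c₀) / ((t₀ : ℝ) + 4 - c₀) := ⟨_, rfl⟩
  obtain ⟨R, hR⟩ : ∃ e : ℝ, e = ((S.card : ℝ) * ((S.card : ℝ) - 2)) /
    ((((t₀ : ℝ) + 6 - c₀)) * ((S.card : ℝ) - (t₀ + 6) - c₀)) := ⟨_, rfl⟩
  rw [← hθ₂, ← hθ₁, ← hR]
  obtain ⟨U0, hU0⟩ := hne
  have hSc : t₀ + 6 + (c₀ + 2) ≤ S.card := add_le_of_mem_shellIn hπ hS hU0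
  have hne : (shellIn π S (t₀ + 6) (c₀ + 2)).Nonempty := ⟨U0, hU0⟩
  have hclt : (c₀ : ℝ) < (t₀ : ℝ) + 2 := by exact_mod_cast hc
  have hS8 : ((t₀ : ℝ) + 6) + (c₀ + 2) ≤ S.card := by exact_mod_cast hSc
  have hT2 : 0 < (t₀ : ℝ) + 2 - c₀ := by linarith
  have hT4 : 0 < (t₀ : ℝ) + 4 - c₀ := by linarith
  have hT6 : 0 < (t₀ : ℝ) + 6 - c₀ := by linarith
  have hθ₂1 : 0 ≤ θ₂ - 1 := by
    rw [hθ₂, sub_nonneg, le_div_iff₀ hT2]; linarith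
  have hθ₁1 : 0 ≤ θ₁ - 1 := by
    rw [hθ₁, sub_nonneg, le_div_iff₀ hT4]; linarith
  have hc0 : (0 : ℝ) ≤ c₀ := Nat.cast_nonneg _
  have hpos : 0 < (((t₀ + 4 : ℕ) : ℝ) + 2 - c₀) * ((S.card : ℝ) - ((t₀ + 4 : ℕ) + 2) - c₀) := by
    push_cast
    exact mul_pos (by linarith) (by linarith)
  have hK : 0 < (S.card : ℝ) * ((S.card : ℝ) - 2) := by
    have : (8 : ℝ) ≤ S.card := by linarith
    exact mul_pos (by linarith) (by linarith)
  have hR0 : 0 ≤ R := by rw [hR]; exact div_nonneg hK.le (mul_pos hT6 (by linarith)).le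
  have eR : ((S.card : ℝ) * ((S.card : ℝ) - 2)) /
      ((((t₀ + 4 : ℕ) : ℝ) + 2 - c₀) * ((S.card : ℝ) - (((t₀ + 4 : ℕ) : ℝ) + 2) - c₀)) = R := by
    rw [hR]; push_cast; ring
  -- nonnegativity of the sections on `S`
  have hP₁0 : 0 ≤ P₁ S (t₀ + 6) x := by
    rw [hP₁]; exact div_nonneg (sum_nonneg fun _ _ => sq_nonneg _) (Nat.cast_nonneg _)
  have hP₂0 : 0 ≤ P₂ S (t₀ + 6) x := by
    rw [hP₂]; exact div_nonneg (sum_nonneg fun _ _ => natCast_mul_sub_one_nonneg _) (Nat.cast_nonneg _)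
  have hP₃0 : 0 ≤ P₃ S (t₀ + 6) x := by
    rw [hP₃]; exact div_nonneg (sum_nonneg fun _ _ => Nat.cast_nonneg _) (Nat.cast_nonneg _)
  -- the combined weighted section and `main_one_eq`
  obtain ⟨W, hW⟩ : ∃ W : Finset (Fin n) → ℤ → ℝ, ∀ S' y, W S' y =
      P₁ S' (t₀ + 4) y + (θ₂ - 1) * P₂ S' (t₀ + 4) y + (θ₁ - 1) * (1 - 2 * m) * P₃ S' (t₀ + 4) y := ⟨_, fun _ _ => rfl⟩
  have hWsec : ∀ S' y, W S' y = (∑ U ∈ ((shellIn π S' (t₀ + 4) c₀).filter fun U => ((U ∩ H).card : ℤ) = y),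
      (1 * (((t₀ : ℝ) + 6 - c₀) / ((t₀ : ℝ) + 2 - c₀)) *
          (((((reps π (vAA π S' H)).filter fun v => v ∈ U ∧ π v ∈ U).card : ℕ) : ℝ) *
            (((((reps π (vAA π S' H)).filter fun v => v ∈ U ∧ π v ∈ U).card : ℕ) : ℝ) - 1)) +
        (1 - 2 * m) * (((t₀ : ℝ) + 6 - c₀) / ((t₀ : ℝ) + 4 - c₀)) *
          ((((reps π (vAA π S' H)).filter fun v => v ∈ U ∧ π v ∈ U).card : ℕ) : ℝ) + m ^ 2)) /
      ((shellIn π S' (t₀ + 4) c₀).card : ℝ) := by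
    intro S' y
    rw [← hθ₂, ← hθ₁, combinedSection_eq, hW, hP₁, hP₂, hP₃]
  have hM := main_one_eq hπ hπ' hS H hc hne 1 (1 - 2 * m) (m ^ 2) x W hWsec
  rw [hM, abs_mul, abs_neg, abs_of_nonneg (by positivity : (0 : ℝ) ≤ 1 / ((S.card : ℝ) * ((S.card : ℝ) - 2)))]
  -- per-pair bound
  have hpair : ∀ p q : Fin n, p ∈ S → q ∈ S → q ≠ p → q ≠ π p → ¬(q ∈ H ∧ π q ∈ H) → ∀ y₀ : ℤ,
      y₀ + ((({q, π q} ∩ H).card : ℕ) : ℤ) = x →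
      (|P₁ (del2 π S p q) (t₀ + 4) x - 2 * P₁ (del2 π S p q) (t₀ + 4) (x - 1) + P₁ (del2 π S p q) (t₀ + 4) (x - 2)| ≤
          E * P₁ (del2 π S p q) (t₀ + 4) y₀ + F₁) →
      (|P₂ (del2 π S p q) (t₀ + 4) x - 2 * P₂ (del2 π S p q) (t₀ + 4) (x - 1) + P₂ (del2 π S p q) (t₀ + 4) (x - 2)| ≤
          E * P₂ (del2 π S p q) (t₀ + 4) y₀ + F₂) →
      (|P₃ (del2 π S p q) (t₀ + 4) x - 2 * P₃ (del2 π S p q) (t₀ + 4) (x - 1) + P₃ (del2 π S p q) (t₀ + 4) (x - 2)| ≤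
          E * P₃ (del2 π S p q) (t₀ + 4) y₀ + F₃) →
      |W (del2 π S p q) x - 2 * W (del2 π S p q) (x - 1) + W (del2 π S p q) (x - 2)| ≤
        E * R * (P₁ S (t₀ + 6) x + (θ₂ - 1) * P₂ S (t₀ + 6) x + (θ₁ - 1) * |1 - 2 * m| * P₃ S (t₀ + 6) x) +
          (F₁ + (θ₂ - 1) * F₂ + (θ₁ - 1) * |1 - 2 * m| * F₃) := by
    intro p q hp hq hqp hqπ hqH y₀ hy h1 h2 h3
    -- comparability of the three sections of `S_pq` at `y₀` with those of `S` at `x`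
    have c1 : P₁ (del2 π S p q) (t₀ + 4) y₀ ≤ R * P₁ S (t₀ + 6) x := by
      have h := weightedSection_del2_le_ratio_mul hπ hπ' hS H hp hq hqp hqπ hqH (t₀ + 4) c₀ hpos
        (fun k : ℕ => ((k : ℝ) - m) ^ 2) (fun _ => sq_nonneg _) y₀
      rw [hy, eR] at h
      rw [hP₁, hP₁]
      exact h
    have c2 : P₂ (del2 π S p q) (t₀ + 4) y₀ ≤ R * P₂ S (t₀ + 6) x := by
      have h := weightedSection_del2_le_ratio_mul hπ hπ' hS H hp hq hqp hqπ hqH (t₀ + 4) c₀ hpos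
        (fun k : ℕ => (k : ℝ) * ((k : ℝ) - 1)) (fun k => natCast_mul_sub_one_nonneg k) y₀
      rw [hy, eR] at h
      rw [hP₂, hP₂]
      exact h
    have c3 : P₃ (del2 π S p q) (t₀ + 4) y₀ ≤ R * P₃ S (t₀ + 6) x := by
      have h := weightedSection_del2_le_ratio_mul hπ hπ' hS H hp hq hqp hqπ hqH (t₀ + 4) c₀ hpos
        (fun k : ℕ => (k : ℝ)) (fun k => Nat.cast_nonneg k) y₀
      rw [hy, eR] at h
      rw [hP₃, hP₃]
      exact h
    rw [hW, hW, hW]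
    refine (abs_nab2_combination_le hθ₂1 x).trans ?_
    rw [abs_mul, abs_of_nonneg hθ₁1]
    have e1 : |P₁ (del2 π S p q) (t₀ + 4) x - 2 * P₁ (del2 π S p q) (t₀ + 4) (x - 1) +
        P₁ (del2 π S p q) (t₀ + 4) (x - 2)| ≤ E * (R * P₁ S (t₀ + 6) x) + F₁ :=
      h1.trans (by linarith [mul_le_mul_of_nonneg_left c1 hE])
    have e2 : |P₂ (del2 π S p q) (t₀ + 4) x - 2 * P₂ (del2 π S p q) (t₀ + 4) (x - 1) +
        P₂ (del2 π S p q) (t₀ + 4) (x - 2)| ≤ E * (R * P₂ S (t₀ + 6) x) + F₂ :=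
      h2.trans (by linarith [mul_le_mul_of_nonneg_left c2 hE])
    have e3 : |P₃ (del2 π S p q) (t₀ + 4) x - 2 * P₃ (del2 π S p q) (t₀ + 4) (x - 1) +
        P₃ (del2 π S p q) (t₀ + 4) (x - 2)| ≤ E * (R * P₃ S (t₀ + 6) x) + F₃ :=
      h3.trans (by linarith [mul_le_mul_of_nonneg_left c3 hE])
    have hm0 : 0 ≤ |1 - 2 * m| := abs_nonneg _
    have e2' := mul_le_mul_of_nonneg_left e2 hθ₂1
    have e3' := mul_le_mul_of_nonneg_left e3 (mul_nonneg hθ₁1 hm0)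
    linarith [e1, e2', e3']
  -- the AD pairs (re-insert the `H̄H̄` edge `e_q`: no shift) and the BB pairs (re-insert the mixed edge `e_q`: shift one)
  have hAD : ∀ p ∈ vAA π S H, ∀ q ∈ vDD π S H,
      |W (del2 π S p q) x - 2 * W (del2 π S p q) (x - 1) + W (del2 π S p q) (x - 2)| ≤
        E * R * (P₁ S (t₀ + 6) x + (θ₂ - 1) * P₂ S (t₀ + 6) x + (θ₁ - 1) * |1 - 2 * m| * P₃ S (t₀ + 6) x) +
          (F₁ + (θ₂ - 1) * F₂ + (θ₁ - 1) * |1 - 2 * m| * F₃) := by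
    intro p hp q hq
    obtain ⟨hpS, hpH, hπpH⟩ := mem_vAA.1 hp
    obtain ⟨hqS, hqH, hπqH⟩ := mem_vDD.1 hq
    obtain ⟨h1, h2, h3⟩ := hXA p hp q hq
    refine hpair p q hpS hqS (fun e => hqH (by rw [e]; exact hpH)) (fun e => hqH (by rw [e]; exact hπpH))
      (fun h => hqH h.1) x ?_ h1 h2 h3
    rw [card_pair_inter_DD hqH hπqH, add_zero]
  have hBB : ∀ p ∈ vBH π S H, ∀ q ∈ (vBN π S H).erase (π p),
      |W (del2 π S p q) x - 2 * W (del2 π S p q) (x - 1) + W (del2 π S p q) (x - 2)| ≤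
        E * R * (P₁ S (t₀ + 6) x + (θ₂ - 1) * P₂ S (t₀ + 6) x + (θ₁ - 1) * |1 - 2 * m| * P₃ S (t₀ + 6) x) +
          (F₁ + (θ₂ - 1) * F₂ + (θ₁ - 1) * |1 - 2 * m| * F₃) := by
    intro p hp q hq
    obtain ⟨hpS, hpH, -⟩ := mem_vBH.1 hp
    obtain ⟨hqπp, hq'⟩ := mem_erase.1 hq
    obtain ⟨hqS, hqH, hπqH⟩ := mem_vBN.1 hq'
    obtain ⟨h1, h2, h3⟩ := hXB p hp q hq
    refine hpair p q hpS hqS (fun e => hqH (by rw [e]; exact hpH)) hqπp (fun h => hqH h.1) (x - 1) ?_ h1 h2 h3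
    rw [card_pair_inter_BN hqH hπqH]
    ring
  -- sum over the pairs
  set Bnd := E * R * (P₁ S (t₀ + 6) x + (θ₂ - 1) * P₂ S (t₀ + 6) x + (θ₁ - 1) * |1 - 2 * m| * P₃ S (t₀ + 6) x) +
    (F₁ + (θ₂ - 1) * F₂ + (θ₁ - 1) * |1 - 2 * m| * F₃) with hBnd
  have hsumA : |∑ p ∈ vAA π S H, ∑ q ∈ vDD π S H,
      (W (del2 π S p q) x - 2 * W (del2 π S p q) (x - 1) + W (del2 π S p q) (x - 2))| ≤
      ((vAA π S H).card : ℝ) * (vDD π S H).card * Bnd := by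
    refine (abs_sum_le_sum_abs _ _).trans ?_
    calc ∑ p ∈ vAA π S H, |∑ q ∈ vDD π S H, (W (del2 π S p q) x - 2 * W (del2 π S p q) (x - 1) + W (del2 π S p q) (x - 2))|
        ≤ ∑ p ∈ vAA π S H, ∑ q ∈ vDD π S H, Bnd :=
          sum_le_sum fun p hp => (abs_sum_le_sum_abs _ _).trans (sum_le_sum fun q hq => hAD p hp q hq)
      _ = _ := by rw [sum_const, sum_const]; simp only [nsmul_eq_mul]; ring
  have hsumB : |∑ p ∈ vBH π S H, ∑ q ∈ (vBN π S H).erase (π p),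
      (W (del2 π S p q) x - 2 * W (del2 π S p q) (x - 1) + W (del2 π S p q) (x - 2))| ≤
      (∑ p ∈ vBH π S H, (((vBN π S H).erase (π p)).card : ℝ)) * Bnd := by
    refine (abs_sum_le_sum_abs _ _).trans ?_
    calc ∑ p ∈ vBH π S H, |∑ q ∈ (vBN π S H).erase (π p),
          (W (del2 π S p q) x - 2 * W (del2 π S p q) (x - 1) + W (del2 π S p q) (x - 2))|
        ≤ ∑ p ∈ vBH π S H, ∑ q ∈ (vBN π S H).erase (π p), Bnd :=
          sum_le_sum fun p hp => (abs_sum_le_sum_abs _ _).trans (sum_le_sum fun q hq => hBB p hp q hq)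
      _ = _ := by rw [sum_mul]; exact sum_congr rfl fun p _ => by rw [sum_const, nsmul_eq_mul]
  have hBnd0 : 0 ≤ Bnd := by
    rw [hBnd]
    have : 0 ≤ |1 - 2 * m| := abs_nonneg _
    positivity
  calc 1 / ((S.card : ℝ) * ((S.card : ℝ) - 2)) *
        |(∑ p ∈ vAA π S H, ∑ q ∈ vDD π S H,
            (W (del2 π S p q) x - 2 * W (del2 π S p q) (x - 1) + W (del2 π S p q) (x - 2))) -
          ∑ p ∈ vBH π S H, ∑ q ∈ (vBN π S H).erase (π p),
            (W (del2 π S p q) x - 2 * W (del2 π S p q) (x - 1) + W (del2 π S p q) (x - 2))|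
      ≤ 1 / ((S.card : ℝ) * ((S.card : ℝ) - 2)) *
          (((vAA π S H).card : ℝ) * (vDD π S H).card * Bnd +
            (∑ p ∈ vBH π S H, (((vBN π S H).erase (π p)).card : ℝ)) * Bnd) :=
        mul_le_mul_of_nonneg_left ((abs_sub _ _).trans (add_le_add hsumA hsumB)) (by positivity)
    _ = _ := by rw [hBnd]; ring

/-- **THE FIRST LEVEL DIFFERENCE OF THE CENTRED SECOND MOMENT, conditional form.** Under the hypotheses of
`abs_main_one_le` (per-pair `x`-smoothness numbers `E, F₁, F₂, F₃` for the three weighted sections of the deleted ground sets),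
with `A^m_c(x) = E_{S,t₀+6,c}[1_{X=x}(n_A−m)²]`, `B^m_c(x) = E_{S,t₀+6,c}[1_{X=x}(n_A−m)]`:
`|A^m_{c₀+2}(x) − A^m_{c₀}(x)| ≤ MAIN-bound + (4/(t₀+2−c₀))·A^m_{c₀}(x) + |2m−1|·(2(t₀+6−c₀)/((t₀+4−c₀)(t₀+2−c₀)))·|B^m_{c₀+2}(x)|
  + (|2m(4m+c₀−t₀−6)|/((t₀+4−c₀)(t₀+2−c₀)))·law_S(t₀+6,c₀+2;x)`
(`levelStep_centredSecond_eq`: `(1 + 4/(t₀+2−c₀))(A^m_{c₀+2} − A^m_{c₀}) = MAIN₁ − (4/(t₀+2−c₀))A^m_{c₀} − βB^m_{c₀+2} − γ·law_{c₀+2}`).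
At `c₀ = 1`, `m = E_1[n_A|X=x]`: `B^m_3 = Δ_cB^m(1)` is one level difference of the centred first moment.
[cite: Rothvoss2017, §2 (PDF p. 6)] [cite: RollinRoss2010, §3 (Lemma 3.3)] -/
theorem abs_levelStep_centredSecond_le {S : Finset (Fin n)} (hS : ∀ u ∈ S, π u ∈ S) (H : Finset (Fin n)) {t₀ c₀ : ℕ}
    (hc : c₀ < t₀ + 2) (hne : (shellIn π S (t₀ + 6) (c₀ + 2)).Nonempty) (m : ℝ) (x : ℤ)
    (P₁ P₂ P₃ : Finset (Fin n) → ℕ → ℤ → ℝ)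
    (hP₁ : ∀ S' t' y, P₁ S' t' y = (∑ U ∈ ((shellIn π S' t' c₀).filter fun U => ((U ∩ H).card : ℤ) = y),
        (((((reps π (vAA π S' H)).filter fun v => v ∈ U ∧ π v ∈ U).card : ℕ) : ℝ) - m) ^ 2) /
        ((shellIn π S' t' c₀).card : ℝ))
    (hP₂ : ∀ S' t' y, P₂ S' t' y = (∑ U ∈ ((shellIn π S' t' c₀).filter fun U => ((U ∩ H).card : ℤ) = y),
        (((((reps π (vAA π S' H)).filter fun v => v ∈ U ∧ π v ∈ U).card : ℕ) : ℝ) *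
          (((((reps π (vAA π S' H)).filter fun v => v ∈ U ∧ π v ∈ U).card : ℕ) : ℝ) - 1))) /
        ((shellIn π S' t' c₀).card : ℝ))
    (hP₃ : ∀ S' t' y, P₃ S' t' y = (∑ U ∈ ((shellIn π S' t' c₀).filter fun U => ((U ∩ H).card : ℤ) = y),
        ((((reps π (vAA π S' H)).filter fun v => v ∈ U ∧ π v ∈ U).card : ℕ) : ℝ)) /
        ((shellIn π S' t' c₀).card : ℝ))
    {E F₁ F₂ F₃ : ℝ} (hE : 0 ≤ E) (hF₁ : 0 ≤ F₁) (hF₂ : 0 ≤ F₂) (hF₃ : 0 ≤ F₃)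
    (hXA : ∀ p ∈ vAA π S H, ∀ q ∈ vDD π S H,
      |P₁ (del2 π S p q) (t₀ + 4) x - 2 * P₁ (del2 π S p q) (t₀ + 4) (x - 1) + P₁ (del2 π S p q) (t₀ + 4) (x - 2)| ≤
          E * P₁ (del2 π S p q) (t₀ + 4) x + F₁ ∧
        |P₂ (del2 π S p q) (t₀ + 4) x - 2 * P₂ (del2 π S p q) (t₀ + 4) (x - 1) + P₂ (del2 π S p q) (t₀ + 4) (x - 2)| ≤
          E * P₂ (del2 π S p q) (t₀ + 4) x + F₂ ∧
        |P₃ (del2 π S p q) (t₀ + 4) x - 2 * P₃ (del2 π S p q) (t₀ + 4) (x - 1) + P₃ (del2 π S p q) (t₀ + 4) (x - 2)| ≤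
          E * P₃ (del2 π S p q) (t₀ + 4) x + F₃)
    (hXB : ∀ p ∈ vBH π S H, ∀ q ∈ (vBN π S H).erase (π p),
      |P₁ (del2 π S p q) (t₀ + 4) x - 2 * P₁ (del2 π S p q) (t₀ + 4) (x - 1) + P₁ (del2 π S p q) (t₀ + 4) (x - 2)| ≤
          E * P₁ (del2 π S p q) (t₀ + 4) (x - 1) + F₁ ∧
        |P₂ (del2 π S p q) (t₀ + 4) x - 2 * P₂ (del2 π S p q) (t₀ + 4) (x - 1) + P₂ (del2 π S p q) (t₀ + 4) (x - 2)| ≤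
          E * P₂ (del2 π S p q) (t₀ + 4) (x - 1) + F₂ ∧
        |P₃ (del2 π S p q) (t₀ + 4) x - 2 * P₃ (del2 π S p q) (t₀ + 4) (x - 1) + P₃ (del2 π S p q) (t₀ + 4) (x - 2)| ≤
          E * P₃ (del2 π S p q) (t₀ + 4) (x - 1) + F₃) :
    |(∑ U ∈ ((shellIn π S (t₀ + 6) (c₀ + 2)).filter fun U => ((U ∩ H).card : ℤ) = x),
          (((((reps π (vAA π S H)).filter fun v => v ∈ U ∧ π v ∈ U).card : ℕ) : ℝ) - m) ^ 2) /
          ((shellIn π S (t₀ + 6) (c₀ + 2)).card : ℝ) - P₁ S (t₀ + 6) x| ≤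
      ((((vAA π S H).card : ℝ) * (vDD π S H).card + ∑ p ∈ vBH π S H, (((vBN π S H).erase (π p)).card : ℝ)) /
          ((S.card : ℝ) * ((S.card : ℝ) - 2))) *
        (E * (((S.card : ℝ) * ((S.card : ℝ) - 2)) / ((((t₀ : ℝ) + 6 - c₀)) * ((S.card : ℝ) - (t₀ + 6) - c₀))) *
            (P₁ S (t₀ + 6) x + (((t₀ : ℝ) + 6 - c₀) / ((t₀ : ℝ) + 2 - c₀) - 1) * P₂ S (t₀ + 6) x +
              (((t₀ : ℝ) + 6 - c₀) / ((t₀ : ℝ) + 4 - c₀) - 1) * |1 - 2 * m| * P₃ S (t₀ + 6) x) +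
          (F₁ + (((t₀ : ℝ) + 6 - c₀) / ((t₀ : ℝ) + 2 - c₀) - 1) * F₂ +
            (((t₀ : ℝ) + 6 - c₀) / ((t₀ : ℝ) + 4 - c₀) - 1) * |1 - 2 * m| * F₃)) +
      (4 / ((t₀ : ℝ) + 2 - c₀)) * P₁ S (t₀ + 6) x +
      |2 * m - 1| * (2 * ((t₀ : ℝ) + 6 - c₀) / (((t₀ : ℝ) + 4 - c₀) * ((t₀ : ℝ) + 2 - c₀))) *
        |(∑ U ∈ ((shellIn π S (t₀ + 6) (c₀ + 2)).filter fun U => ((U ∩ H).card : ℤ) = x),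
            (((((reps π (vAA π S H)).filter fun v => v ∈ U ∧ π v ∈ U).card : ℕ) : ℝ) - m)) /
            ((shellIn π S (t₀ + 6) (c₀ + 2)).card : ℝ)| +
      (|2 * m * (4 * m + c₀ - t₀ - 6)| / (((t₀ : ℝ) + 4 - c₀) * ((t₀ : ℝ) + 2 - c₀))) *
        shellLaw π S H (t₀ + 6) (c₀ + 2) x := by
  classical
  have hmain := abs_main_one_le hπ hπ' hS H hc hne m x P₁ P₂ P₃ hP₁ hP₂ hP₃ hE hF₁ hF₂ hF₃ hXA hXB
  -- the same combined section as inside `abs_main_one_le`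
  obtain ⟨W, hW⟩ : ∃ W : Finset (Fin n) → ℤ → ℝ, ∀ S' y, W S' y =
      (∑ U ∈ ((shellIn π S' (t₀ + 4) c₀).filter fun U => ((U ∩ H).card : ℤ) = y),
      (1 * (((t₀ : ℝ) + 6 - c₀) / ((t₀ : ℝ) + 2 - c₀)) *
          (((((reps π (vAA π S' H)).filter fun v => v ∈ U ∧ π v ∈ U).card : ℕ) : ℝ) *
            (((((reps π (vAA π S' H)).filter fun v => v ∈ U ∧ π v ∈ U).card : ℕ) : ℝ) - 1)) +
        (1 - 2 * m) * (((t₀ : ℝ) + 6 - c₀) / ((t₀ : ℝ) + 4 - c₀)) *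
          ((((reps π (vAA π S' H)).filter fun v => v ∈ U ∧ π v ∈ U).card : ℕ) : ℝ) + m ^ 2)) /
      ((shellIn π S' (t₀ + 4) c₀).card : ℝ) := ⟨_, fun _ _ => rfl⟩
  have hM := main_one_eq hπ hπ' hS H hc hne 1 (1 - 2 * m) (m ^ 2) x W hW
  have hL := levelStep_centredSecond_eq hπ hπ' hS H hc hne m x W hW
  rw [← hM] at hL
  rw [← hP₁ S (t₀ + 6) x] at hL
  -- sizes and signs
  obtain ⟨U0, hU0⟩ := hne
  have hSc : t₀ + 6 + (c₀ + 2) ≤ S.card := add_le_of_mem_shellIn hπ hS hU0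
  have hclt : (c₀ : ℝ) < (t₀ : ℝ) + 2 := by exact_mod_cast hc
  have hT2 : 0 < (t₀ : ℝ) + 2 - c₀ := by linarith
  have hT4 : 0 < (t₀ : ℝ) + 4 - c₀ := by linarith
  have hε : 0 ≤ 4 / ((t₀ : ℝ) + 2 - c₀) := by positivity
  have hP₁0 : 0 ≤ P₁ S (t₀ + 6) x := by
    rw [hP₁]; exact div_nonneg (sum_nonneg fun _ _ => sq_nonneg _) (Nat.cast_nonneg _)
  have hlaw0 : 0 ≤ shellLaw π S H (t₀ + 6) (c₀ + 2) x := by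
    rw [shellLaw, shellCount]; positivity
  -- abbreviate the four quantities
  generalize hA3 : (∑ U ∈ ((shellIn π S (t₀ + 6) (c₀ + 2)).filter fun U => ((U ∩ H).card : ℤ) = x),
      (((((reps π (vAA π S H)).filter fun v => v ∈ U ∧ π v ∈ U).card : ℕ) : ℝ) - m) ^ 2) /
      ((shellIn π S (t₀ + 6) (c₀ + 2)).card : ℝ) = A3 at hL ⊢
  generalize hB3 : (∑ U ∈ ((shellIn π S (t₀ + 6) (c₀ + 2)).filter fun U => ((U ∩ H).card : ℤ) = x),
      (((((reps π (vAA π S H)).filter fun v => v ∈ U ∧ π v ∈ U).card : ℕ) : ℝ) - m)) /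
      ((shellIn π S (t₀ + 6) (c₀ + 2)).card : ℝ) = B3 at hL ⊢
  generalize hMM : 1 * ((((t₀ : ℝ) + 6 - c₀) * ((t₀ : ℝ) + 4 - c₀)) / ((S.card : ℝ) * ((S.card : ℝ) - 2))) *
          ((∑ v ∈ reps π (vAA π S H), ∑ w ∈ (reps π (vAA π S H)).erase v,
              shellLaw π (del2 π S v w) H (t₀ + 2) (c₀ + 2) (x - 4)) -
            ∑ v ∈ reps π (vAA π S H), ∑ w ∈ (reps π (vAA π S H)).erase v,
              shellLaw π (del2 π S v w) H (t₀ + 2) c₀ (x - 4)) +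
        (1 - 2 * m) * (((t₀ : ℝ) + 6 - c₀) / (S.card : ℝ)) *
          ((∑ v ∈ reps π (vAA π S H), shellLaw π (S \ {v, π v}) H (t₀ + 4) (c₀ + 2) (x - 2)) -
            ∑ v ∈ reps π (vAA π S H), shellLaw π (S \ {v, π v}) H (t₀ + 4) c₀ (x - 2)) +
        m ^ 2 * (shellLaw π S H (t₀ + 6) (c₀ + 2) x - shellLaw π S H (t₀ + 6) c₀ x) = MM at hL hmain ⊢
  generalize hBd : ((((vAA π S H).card : ℝ) * (vDD π S H).card +
      ∑ p ∈ vBH π S H, (((vBN π S H).erase (π p)).card : ℝ)) / ((S.card : ℝ) * ((S.card : ℝ) - 2))) *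
        (E * (((S.card : ℝ) * ((S.card : ℝ) - 2)) / ((((t₀ : ℝ) + 6 - c₀)) * ((S.card : ℝ) - (t₀ + 6) - c₀))) *
            (P₁ S (t₀ + 6) x + (((t₀ : ℝ) + 6 - c₀) / ((t₀ : ℝ) + 2 - c₀) - 1) * P₂ S (t₀ + 6) x +
              (((t₀ : ℝ) + 6 - c₀) / ((t₀ : ℝ) + 4 - c₀) - 1) * |1 - 2 * m| * P₃ S (t₀ + 6) x) +
          (F₁ + (((t₀ : ℝ) + 6 - c₀) / ((t₀ : ℝ) + 2 - c₀) - 1) * F₂ +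
            (((t₀ : ℝ) + 6 - c₀) / ((t₀ : ℝ) + 4 - c₀) - 1) * |1 - 2 * m| * F₃)) = Bd at hmain ⊢
  generalize hL3 : shellLaw π S H (t₀ + 6) (c₀ + 2) x = L3 at hL hlaw0 ⊢
  generalize hA1 : P₁ S (t₀ + 6) x = A1 at hL hP₁0 ⊢
  -- `(1 + ε)(A3 − A1) = MM − εA1 − βB3 − γL3`
  set ε := 4 / ((t₀ : ℝ) + 2 - c₀) with hεdef
  set β := (2 * m - 1) * (2 * ((t₀ : ℝ) + 6 - c₀) / (((t₀ : ℝ) + 4 - c₀) * ((t₀ : ℝ) + 2 - c₀))) with hβdef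
  set γ := 2 * m * (4 * m + c₀ - t₀ - 6) / (((t₀ : ℝ) + 4 - c₀) * ((t₀ : ℝ) + 2 - c₀)) with hγdef
  have hkey : (1 + ε) * (A3 - A1) = MM - ε * A1 - β * B3 - γ * L3 := by linear_combination hL
  have h1ε : 1 ≤ 1 + ε := by linarith
  have hβabs : |β| = |2 * m - 1| * (2 * ((t₀ : ℝ) + 6 - c₀) / (((t₀ : ℝ) + 4 - c₀) * ((t₀ : ℝ) + 2 - c₀))) := by
    rw [hβdef, abs_mul, abs_of_nonneg (div_nonneg (by linarith) (mul_pos hT4 hT2).le :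
      (0 : ℝ) ≤ 2 * ((t₀ : ℝ) + 6 - c₀) / (((t₀ : ℝ) + 4 - c₀) * ((t₀ : ℝ) + 2 - c₀)))]
  have hγabs : |γ| = |2 * m * (4 * m + c₀ - t₀ - 6)| / (((t₀ : ℝ) + 4 - c₀) * ((t₀ : ℝ) + 2 - c₀)) := by
    rw [hγdef, abs_div, abs_of_pos (mul_pos hT4 hT2)]
  calc |A3 - A1| ≤ (1 + ε) * |A3 - A1| := le_mul_of_one_le_left (abs_nonneg _) h1ε
    _ = |MM - ε * A1 - β * B3 - γ * L3| := by
        rw [← abs_of_pos (by linarith : (0 : ℝ) < 1 + ε), ← abs_mul, hkey]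
    _ ≤ |MM| + ε * A1 + |β| * |B3| + |γ| * L3 := by
        have e1 : |MM - ε * A1 - β * B3 - γ * L3| ≤ |MM - ε * A1 - β * B3| + |γ * L3| := abs_sub _ _
        have e2 : |MM - ε * A1 - β * B3| ≤ |MM - ε * A1| + |β * B3| := abs_sub _ _
        have e3 : |MM - ε * A1| ≤ |MM| + |ε * A1| := abs_sub _ _
        have e4 : |γ * L3| = |γ| * L3 := by rw [abs_mul, abs_of_nonneg hlaw0]
        have e5 : |β * B3| = |β| * |B3| := abs_mul _ _
        have e6 : |ε * A1| = ε * A1 := by rw [abs_mul, abs_of_nonneg hε, abs_of_nonneg hP₁0]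
        rw [e4] at e1
        rw [e5] at e2
        rw [e6] at e3
        linarith
    _ ≤ Bd + ε * A1 + |β| * |B3| + |γ| * L3 := by linarith [hmain]
    _ = _ := by rw [hβabs, hγabs]

end Main

end ShellStep

end Literature.Combinatorics.Optimization

end
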